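import Summits.HodgeConjecture.HodgeConjecture.Theorems.SixfoldTableXCensusWeilEndFieldRowsOfLie
import Summits.HodgeConjecture.HodgeConjecture.Theorems.SixfoldTableXCensusWeilRow9KSymmOfLie
import Literature.AlgebraicGeometry.HodgeTheory.WeilTypeSixfoldHodgeLieSU
import HarnessLib

/-!
# TABLE X (dimension 6) — the Weil-type rows with `End⁰ = K` EXACTLY, ALL MEMBERS: the census nodes X2 ∕ X1 (+ domain,
# isogeny class) and the «HC ⟸ {Markman₆, R-W6} ∕ ⟸ WeilSixfolds» corollaries with NO displayed Hodge-group and NO displayed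
# Lie hypothesis (cell `pub-hodgeav-hg6`, req-37 (A) Q2b; eng-3 g3, job B5c; lead g3 2026-08-29T04:53:48Z)

HONEST FRAMING. HC, `HC_AV` (stmt-1333), `HC_CM` (stmt-3052) and H2 are NOT proved and do not occur. X2 ∕ X1 stay
`@[conjecture]` (OURS) — what is proved is the census verdict «X2-at-`A` ∧ X1-at-`A`» for the members named; R-W6, Markman₆
(preprint, unrefereed) and `WeilSixfolds` (stmt-2524) appear only as displayed hypotheses of the HC corollaries. KERNEL ONLY:
one-line theorems over existing declarations; no definition, no `sorry`, no named fact; restates nothing.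

WHAT THIS FILE DOES. The B5b modules `SixfoldTableXCensusWeilEndFieldRowsOfLie` (row 9 keyed by a class `h` with `Q_h`
non-degenerate, `φ^*` a `d`-similitude) and `SixfoldTableXCensusWeilRow9KSymmOfLie` (row 9 keyed by van Geemen's `h_K`) display
ONE hypothesis beyond the row data: the Lie statement `hSU` («every operator on `H¹(A;ℂ)` commuting with `φ_ℂ`, skew for `ψ_ℂ`,
traceless on `W_K` lies in `Lie Hg ⊗ ℂ`», for every polarization `ψ`). Brick B4′
`IsWeilType.mem_hodgeLieC_of_commute_of_skew_of_trace` (eng-4 g7, `HodgeTheory/WeilTypeSixfoldHodgeLieSU`: the (3|3) Weil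
square B1 ⟹ S1 ⟹ S2 ⟹ S3, both twists dead) proves `hSU` for EVERY Weil-type sixfold `(3, d)` with `finrank_ℚ End⁰(A) = 2`.
This file is the one-line-per-theorem discharge `fun ψ ↦ B4′ hW hE2 ψ`: every theorem below is the corresponding `_ofLie` theorem
with the binder `hSU` DELETED and nothing else changed. Consequently every Weil-type sixfold with `End⁰ = K` exactly — row 9
`g6.Weil.k.(3,3)`, which therefore has NO special members — satisfies the census X2 ∕ X1 (+ domain `¬ 𝒞`, + isogeny class) in the
KERNEL with no displayed Hodge-group or Lie hypothesis; HC there ⟸ the displayed Markman₆ ∕ R-W6 ∕ WeilSixfolds binders only.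
Rows 11 ∕ 13 (members with `End⁰ = E ⊋ K`) keep their displayed `hG` (lead ruling; job B5a-E). The group-level statements
(`HasHodgeGroupSU A φ 3 d h_K` unconditionally; the `hG` binder of W1G ∕ L16–L18 for `End⁰ = K`) are
`IsWeilType.hasHodgeGroupSU_ksymm_of_finrank_endAlgebra_eq_two` (eng-4 g7) and `hG_of_finrank_endAlgebra_eq_two` (§0 below).
All declarations in the sub-namespace `TableX.WeilLieRows`; typed ≠ proved.
-/

set_option linter.dupNamespace false

noncomputable section

open scoped TensorProduct
open CategoryTheory
open Literature.AlgebraicGeometry Literature.AlgebraicGeometry.Motives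
open Literature.AlgebraicGeometry.Motives.AbelianVariety (IsIsogenous IsSimple)
open Literature.AlgebraicGeometry.Motives.HodgeStructure
open Literature.AlgebraicGeometry.HodgeTheory
open Literature.AlgebraicGeometry.Milne1999
open Literature.AlgebraicGeometry.VanGeemen1994 (pullbackOne hodgeGroupOne detOnEigenspace HasHodgeGroupSU hK)
open Literature.AlgebraicTopology.SingularHomology
open Literature.Barriers.HodgeConjecture
open Summit.HodgeConjecture.HodgeConjecture.Ring2.ClassTargets
open Summit.HodgeConjecture.HodgeConjecture.Ring2.Motiv (ProdCMCell)
open Summit.HodgeConjecture.HodgeConjecture.Ring2.Atlas (IsQuarticFieldTypeIVFourfold)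

namespace Summit.HodgeConjecture.HodgeConjecture.TableX.WeilLieRows

/-! ## §0 The group-level socket `hG` of W1G ∕ L16–L18 for `End⁰ = K`, now a theorem -/

section Socket

variable {A : AbelianVariety ℂ} {φ : A ⟶ A} {d : ℕ} {h : complexBetti A.X 2}

/-- **The displayed `hG` of W1G ∕ L16–L18 is a THEOREM for every Weil-type sixfold with `End⁰ = K`**: for `(A, φ)` of Weil type
`(3, d)` with `finrank_ℚ End⁰(A) = 2` and a class `h ∈ B¹(A) ⊗ ℂ` with `Q_h` non-degenerate and `φ^*` a `d`-similitude of `Q_h`,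
every `u ∈ S(A)(h)(ℂ)` with `det(u | W_K) = 1` lies in `Hg(A)(ℂ)|_{H¹}` — B5a §4
`IsWeilType.mem_hodgeGroupOne_of_mem_unitaryCentralizerGroup_of_hodgeLieC` ∘ B4′. HC NOT proved.
[cite: Deligne1982HodgeCycles, I §3 Prop. 3.4 and 3.6] [cite: MoonenZarhin1999LowDim, §3 (3.1) and Table 1]
[cite: vanGeemen1994HodgeAV, Thm. 6.12 and 4.9] -/
theorem hG_of_finrank_endAlgebra_eq_two (hW : IsWeilType A φ 3 d) (hE2 : Module.finrank ℚ A.endAlgebra = 2)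
    (hh : h ∈ VanGeemen1994.hodgeClassSpan A.dim A.X 1)
    (hnd : ∀ x : complexBetti A.X 1, (∀ y, polarizationPairingOne A.X h (A.dim - 1) x y = 0) → x = 0)
    (hφQ : ∀ x y, polarizationPairingOne A.X h (A.dim - 1) (pullbackOne A φ x) (pullbackOne A φ y) =
      (d : ℂ) • polarizationPairingOne A.X h (A.dim - 1) x y) :
    ∀ (u : complexBetti A.X 1 ≃ₗ[ℂ] complexBetti A.X 1) (hu : u ∈ unitaryCentralizerGroup A h),
      detOnEigenspace u (pullbackOne A φ) (fun x ↦ (mem_centralizerGroup_iff.1 hu.1) φ x)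
        (Complex.I * (Real.sqrt d : ℂ)) = 1 → u ∈ hodgeGroupOne A.dim A.X := by
  haveI : HodgeTensorFacts.{0, 0} := hodgeTensorFacts_holds
  obtain ⟨ψ⟩ := BettiUniverse.hodge_isPolarizable exists_isReal_hodgeModel_holds
    (AbelianVariety.isSmoothProjective_holds (A := A)) 1
  exact fun u hu hdet ↦ hW.mem_hodgeGroupOne_of_mem_unitaryCentralizerGroup_of_hodgeLieC hE2 ψ
    (hW.mem_hodgeLieC_of_commute_of_skew_of_trace hE2 ψ) hh hnd hφQ u hu hdet

end Socket

/-! ## §1 Row 9 keyed by a class `h` (`Q_h` non-degenerate, `φ^*` a `d`-similitude): every member with `End⁰ = K` -/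

section EndK

variable (A : AbelianVariety ℂ) (φ : A ⟶ A) (d : ℕ)
variable {h : complexBetti A.X 2}

/-- **TABLE X ROW 9 (`End⁰ = K` EXACTLY), EVERY MEMBER, KERNEL VERDICT WITH DOMAIN MEMBERSHIP — NO Lie and NO Hodge-group
hypothesis left.** `census_weilType_endK_ofLie` with its displayed Lie hypothesis `hSU` DISCHARGED by brick B4′
`IsWeilType.mem_hodgeLieC_of_commute_of_skew_of_trace` (eng-4 g7; the (3|3) Weil square): for `(A, φ)` of Weil type `(3, d)` with
`finrank_ℚ End⁰(A) = 2`, the displayed domain membership `¬ 𝒞 A`, and a class `h ∈ B¹(A) ⊗ ℂ` with `Q_h` non-degenerate and `φ^*` a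
`d`-similitude of `Q_h`: `(dim A = 6 ∧ ¬ 𝒞 A) ∧` X2-at-`A` `∧` X1-at-`A`. HC NOT proved (X2 ∕ X1 are census conjuncts, not HC).
[cite: Milne1999LefschetzClasses, Thm. 3.2 and Cor. 4.5] [cite: vanGeemen1994HodgeAV, Thm. 6.12 and 4.9]
[cite: Deligne1982HodgeCycles, I §3 Prop. 3.4 and 3.6] [cite: MoonenZarhin1999LowDim, (2.3), §3 (3.1) and Table 1] -/
theorem census_weilType_endK (hW : IsWeilType A φ 3 d) (hE2 : Module.finrank ℚ A.endAlgebra = 2)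
    (hdom : ¬ (IsOfCMType A ∨ ProdCMCell IsQuarticFieldTypeIVFourfold (fun Z ↦ Z.dim = 2) A))
    (hh : h ∈ VanGeemen1994.hodgeClassSpan A.dim A.X 1)
    (hnd : ∀ x : complexBetti A.X 1, (∀ y, polarizationPairingOne A.X h (A.dim - 1) x y = 0) → x = 0)
    (hφQ : ∀ x y, polarizationPairingOne A.X h (A.dim - 1) (pullbackOne A φ x) (pullbackOne A φ y) =
      (d : ℂ) • polarizationPairingOne A.X h (A.dim - 1) x y) :
    (A.dim = 6 ∧ ¬ (IsOfCMType A ∨ ProdCMCell IsQuarticFieldTypeIVFourfold (fun Z ↦ Z.dim = 2) A)) ∧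
    (∀ c : complexBetti A.X (2 * 2), IsRationalClass c → IsOfHodgeType A.dim A.X (2 * 2) 2 2 c →
      c ∈ divisorClassesSpan A.X A.dim 2 ⊔ Submodule.span ℂ {w' : complexBetti A.X (2 * 2) |
        ∃ (C : AbelianVariety ℂ) (g : A.X ⟶ C.X) (w : complexBetti C.X (2 * 2)), C.dim < A.dim ∧
          IsRationalClass w ∧ IsOfHodgeType C.dim C.X (2 * 2) 2 2 w ∧ w' = complexBetti.map g (2 * 2) w}) ∧
    (∀ c : complexBetti A.X (2 * 3), IsRationalClass c → IsOfHodgeType A.dim A.X (2 * 3) 3 3 c →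
      c ∈ divisorClassesSpan A.X A.dim 3 ⊔ Submodule.span ℂ {w' : complexBetti A.X (2 * 3) |
          ∃ (a : complexBetti A.X (2 * 2)) (b : complexBetti A.X (2 * 1)),
            IsRationalClass a ∧ IsOfHodgeType A.dim A.X (2 * 2) 2 2 a ∧ IsRationalClass b ∧
            IsOfHodgeType A.dim A.X (2 * 1) 1 1 b ∧ w' = cupProduct (two_mul_add_two_mul 2 1) a b} ⊔
        Submodule.span ℂ {w' : complexBetti A.X (2 * 3) |
          ∃ (C : AbelianVariety ℂ) (g : A.X ⟶ C.X) (w : complexBetti C.X (2 * 3)), C.dim < A.dim ∧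
            IsRationalClass w ∧ IsOfHodgeType C.dim C.X (2 * 3) 3 3 w ∧ w' = complexBetti.map g (2 * 3) w} ⊔
        Submodule.span ℂ {w' : complexBetti A.X (2 * 3) |
          ∃ (B' : AbelianVariety ℂ) (g : A.X ⟶ B'.X) (d : ℕ) (ψ : B' ⟶ B') (w : complexBetti B'.X (2 * 3)),
            B'.dim = 6 ∧ 0 < d ∧ ψ ≫ ψ = -(d • 𝟙 B') ∧ IsRationalClass w ∧
            IsOfHodgeType B'.dim B'.X (2 * 3) 3 3 w ∧ w ∈ weilClassesOf B' ψ 3 d ∧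
            w' = complexBetti.map g (2 * 3) w}) := by
  haveI : HodgeTensorFacts.{0, 0} := hodgeTensorFacts_holds
  exact census_weilType_endK_ofLie A φ d hW hE2
    (fun ψ ↦ hW.mem_hodgeLieC_of_commute_of_skew_of_trace hE2 ψ) hdom hh hnd hφQ

/-- **Row 9 (`End⁰ = K`), every member, on the whole ISOGENY CLASS — no Lie ∕ Hodge-group hypothesis.**
[cite: Milne1999LefschetzClasses, Cor. 4.5] [cite: vanGeemen1994HodgeAV, Thm. 6.12 and Lemma 3.7] [cite: MoonenZarhin1999LowDim, §5 (5.1)] -/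
theorem census_weilType_endK_of_isIsogenous {A' : AbelianVariety ℂ} (hW : IsWeilType A φ 3 d)
    (hE2 : Module.finrank ℚ A.endAlgebra = 2)
    (hdom : ¬ (IsOfCMType A ∨ ProdCMCell IsQuarticFieldTypeIVFourfold (fun Z ↦ Z.dim = 2) A))
    (hh : h ∈ VanGeemen1994.hodgeClassSpan A.dim A.X 1)
    (hnd : ∀ x : complexBetti A.X 1, (∀ y, polarizationPairingOne A.X h (A.dim - 1) x y = 0) → x = 0)
    (hφQ : ∀ x y, polarizationPairingOne A.X h (A.dim - 1) (pullbackOne A φ x) (pullbackOne A φ y) =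
      (d : ℂ) • polarizationPairingOne A.X h (A.dim - 1) x y)
    (hA'A : IsIsogenous A' A) :
    (A'.dim = 6 ∧ ¬ (IsOfCMType A' ∨ ProdCMCell IsQuarticFieldTypeIVFourfold (fun Z ↦ Z.dim = 2) A')) ∧
    (∀ c : complexBetti A'.X (2 * 2), IsRationalClass c → IsOfHodgeType A'.dim A'.X (2 * 2) 2 2 c →
      c ∈ divisorClassesSpan A'.X A'.dim 2 ⊔ Submodule.span ℂ {w' : complexBetti A'.X (2 * 2) |
        ∃ (C : AbelianVariety ℂ) (g : A'.X ⟶ C.X) (w : complexBetti C.X (2 * 2)), C.dim < A'.dim ∧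
          IsRationalClass w ∧ IsOfHodgeType C.dim C.X (2 * 2) 2 2 w ∧ w' = complexBetti.map g (2 * 2) w}) ∧
    (∀ c : complexBetti A'.X (2 * 3), IsRationalClass c → IsOfHodgeType A'.dim A'.X (2 * 3) 3 3 c →
      c ∈ divisorClassesSpan A'.X A'.dim 3 ⊔ Submodule.span ℂ {w' : complexBetti A'.X (2 * 3) |
          ∃ (a : complexBetti A'.X (2 * 2)) (b : complexBetti A'.X (2 * 1)),
            IsRationalClass a ∧ IsOfHodgeType A'.dim A'.X (2 * 2) 2 2 a ∧ IsRationalClass b ∧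
            IsOfHodgeType A'.dim A'.X (2 * 1) 1 1 b ∧ w' = cupProduct (two_mul_add_two_mul 2 1) a b} ⊔
        Submodule.span ℂ {w' : complexBetti A'.X (2 * 3) |
          ∃ (C : AbelianVariety ℂ) (g : A'.X ⟶ C.X) (w : complexBetti C.X (2 * 3)), C.dim < A'.dim ∧
            IsRationalClass w ∧ IsOfHodgeType C.dim C.X (2 * 3) 3 3 w ∧ w' = complexBetti.map g (2 * 3) w} ⊔
        Submodule.span ℂ {w' : complexBetti A'.X (2 * 3) |
          ∃ (B' : AbelianVariety ℂ) (g : A'.X ⟶ B'.X) (d : ℕ) (ψ : B' ⟶ B') (w : complexBetti B'.X (2 * 3)),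
            B'.dim = 6 ∧ 0 < d ∧ ψ ≫ ψ = -(d • 𝟙 B') ∧ IsRationalClass w ∧
            IsOfHodgeType B'.dim B'.X (2 * 3) 3 3 w ∧ w ∈ weilClassesOf B' ψ 3 d ∧
            w' = complexBetti.map g (2 * 3) w}) := by
  haveI : HodgeTensorFacts.{0, 0} := hodgeTensorFacts_holds
  exact census_weilType_endK_ofLie_of_isIsogenous A φ d hW hE2
    (fun ψ ↦ hW.mem_hodgeLieC_of_commute_of_skew_of_trace hE2 ψ) hdom hh hnd hφQ hA'A

/-- **HC for every `End⁰ = K` Weil-type sixfold ⟸ the ladder item `WeilSixfolds` (stmt-HodgeConjecture-2524, DISPLAYED, not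
asserted)** — `hodgeConjectureFor_weilType_endK_ofLie_of_weilSixfolds` with `hSU` discharged by B4′. HC NOT proved unconditionally.
[cite: vanGeemen1994HodgeAV, 2.4 and Thm. 6.12] [cite: Milne1999LefschetzClasses, Cor. 4.5] [cite: Deligne1982HodgeCycles, I §3 Prop. 3.4] -/
theorem hodgeConjectureFor_weilType_endK_of_weilSixfolds (hW₆ : Theses.SevenfoldWeilCensus.WeilSixfolds)
    (hW : IsWeilType A φ 3 d) (hE2 : Module.finrank ℚ A.endAlgebra = 2)
    (hh : h ∈ VanGeemen1994.hodgeClassSpan A.dim A.X 1)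
    (hnd : ∀ x : complexBetti A.X 1, (∀ y, polarizationPairingOne A.X h (A.dim - 1) x y = 0) → x = 0)
    (hφQ : ∀ x y, polarizationPairingOne A.X h (A.dim - 1) (pullbackOne A φ x) (pullbackOne A φ y) =
      (d : ℂ) • polarizationPairingOne A.X h (A.dim - 1) x y) :
    HodgeConjectureFor A.dim A.X := by
  haveI : HodgeTensorFacts.{0, 0} := hodgeTensorFacts_holds
  exact hodgeConjectureFor_weilType_endK_ofLie_of_weilSixfolds A φ d hW₆ hW hE2
    (fun ψ ↦ hW.mem_hodgeLieC_of_commute_of_skew_of_trace hE2 ψ) hh hnd hφQ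

/-- **HC for every `End⁰ = K` Weil-type sixfold ⟸ the NAMED RESIDUES {Markman₆, R-W6} (both DISPLAYED: Markman₆ preprint,
UNREFEREED; R-W6 OPEN)** — `…_ofLie_of_markman₆_nonsplit` with `hSU` discharged by B4′. HC NOT proved unconditionally.
[cite: Markman2025SecantWeil, Thm. 1.5.1 (preprint, unrefereed)] [claim: Markman2025SurveySecant, status: under-review]
[cite: vanGeemen1994HodgeAV, Thm. 6.12] [cite: Milne1999LefschetzClasses, Cor. 4.5] -/
theorem hodgeConjectureFor_weilType_endK_of_markman₆_nonsplit
    (hMark₆ : Markman2025_weilClasses_algebraic_hyperbolicSixfold) (hRW6 : WeilTypeLadder.NonsplitSixfolds)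
    (hW : IsWeilType A φ 3 d) (hE2 : Module.finrank ℚ A.endAlgebra = 2)
    (hh : h ∈ VanGeemen1994.hodgeClassSpan A.dim A.X 1)
    (hnd : ∀ x : complexBetti A.X 1, (∀ y, polarizationPairingOne A.X h (A.dim - 1) x y = 0) → x = 0)
    (hφQ : ∀ x y, polarizationPairingOne A.X h (A.dim - 1) (pullbackOne A φ x) (pullbackOne A φ y) =
      (d : ℂ) • polarizationPairingOne A.X h (A.dim - 1) x y) :
    HodgeConjectureFor A.dim A.X := by
  haveI : HodgeTensorFacts.{0, 0} := hodgeTensorFacts_holds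
  exact hodgeConjectureFor_weilType_endK_ofLie_of_markman₆_nonsplit A φ d hMark₆ hRW6 hW hE2
    (fun ψ ↦ hW.mem_hodgeLieC_of_commute_of_skew_of_trace hE2 ψ) hh hnd hφQ

/-- **… and on the whole isogeny class** (`HodgeConjectureFor.of_isIsogenous`). Markman₆ ∕ R-W6 displayed; HC NOT proved
unconditionally. [cite: vanGeemen1994HodgeAV, Lemma 3.7 and Thm. 6.12] [cite: Markman2025SecantWeil, Thm. 1.5.1 (preprint, unrefereed)] -/
theorem hodgeConjectureFor_of_isIsogenous_weilType_endK_of_markman₆_nonsplit {A' : AbelianVariety ℂ}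
    (hMark₆ : Markman2025_weilClasses_algebraic_hyperbolicSixfold) (hRW6 : WeilTypeLadder.NonsplitSixfolds)
    (hW : IsWeilType A φ 3 d) (hE2 : Module.finrank ℚ A.endAlgebra = 2)
    (hh : h ∈ VanGeemen1994.hodgeClassSpan A.dim A.X 1)
    (hnd : ∀ x : complexBetti A.X 1, (∀ y, polarizationPairingOne A.X h (A.dim - 1) x y = 0) → x = 0)
    (hφQ : ∀ x y, polarizationPairingOne A.X h (A.dim - 1) (pullbackOne A φ x) (pullbackOne A φ y) =
      (d : ℂ) • polarizationPairingOne A.X h (A.dim - 1) x y)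
    (hA'A : IsIsogenous A' A) : HodgeConjectureFor A'.dim A'.X := by
  haveI : HodgeTensorFacts.{0, 0} := hodgeTensorFacts_holds
  exact hodgeConjectureFor_of_isIsogenous_weilType_endK_ofLie_of_markman₆_nonsplit A φ d hMark₆ hRW6 hW hE2
    (fun ψ ↦ hW.mem_hodgeLieC_of_commute_of_skew_of_trace hE2 ψ) hh hnd hφQ hA'A

end EndK

/-! ## §2 Row 9 keyed by van Geemen's `h_K`: every member with `End⁰ = K` -/

section KSymm

variable (A : AbelianVariety ℂ) (φ : A ⟶ A) (d : ℕ) (e : ProjectiveEmbedding A.X)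
  (a : complexBetti (projectiveSpace e.n ℂ) 2)

/-- **TABLE X ROW 9 `g6.Weil.k.(3,3)` WITH `h_K`, EVERY MEMBER WITH `End⁰ = K` — NO Lie and NO Hodge-group hypothesis left.**
`census_row9_ksymm_ofLie` with `hSU` discharged by B4′: for `(A, φ)` of Weil type `(3, d)` with `finrank_ℚ End⁰(A) = 2`, a projective
embedding `e` and a rational class `a ≠ 0` on the ambient projective space: `(dim A = 6 ∧ ¬ 𝒞 A) ∧` X2-at-`A` `∧` X1-at-`A`. Row 9 has
NO special members left. HC NOT proved. [cite: vanGeemen1994HodgeAV, Thm. 6.11, Thm. 6.12 and 4.9]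
[cite: Deligne1982HodgeCycles, I §3 Prop. 3.4 and 3.6] [cite: MoonenZarhin1999LowDim, Thm. 0.2, §5 (5.1) and Table 1] -/
theorem census_row9_ksymm (hW : IsWeilType A φ 3 d) (hE2 : Module.finrank ℚ A.endAlgebra = 2)
    (ha : IsRationalClass a) (ha0 : a ≠ 0) :
    (A.dim = 6 ∧ ¬ (IsOfCMType A ∨ ProdCMCell IsQuarticFieldTypeIVFourfold (fun Z ↦ Z.dim = 2) A)) ∧
    (∀ c : complexBetti A.X (2 * 2), IsRationalClass c → IsOfHodgeType A.dim A.X (2 * 2) 2 2 c →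
      c ∈ divisorClassesSpan A.X A.dim 2 ⊔ Submodule.span ℂ {w' : complexBetti A.X (2 * 2) |
        ∃ (C : AbelianVariety ℂ) (g : A.X ⟶ C.X) (w : complexBetti C.X (2 * 2)), C.dim < A.dim ∧
          IsRationalClass w ∧ IsOfHodgeType C.dim C.X (2 * 2) 2 2 w ∧ w' = complexBetti.map g (2 * 2) w}) ∧
    (∀ c : complexBetti A.X (2 * 3), IsRationalClass c → IsOfHodgeType A.dim A.X (2 * 3) 3 3 c →
      c ∈ divisorClassesSpan A.X A.dim 3 ⊔ Submodule.span ℂ {w' : complexBetti A.X (2 * 3) |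
          ∃ (a : complexBetti A.X (2 * 2)) (b : complexBetti A.X (2 * 1)),
            IsRationalClass a ∧ IsOfHodgeType A.dim A.X (2 * 2) 2 2 a ∧ IsRationalClass b ∧
            IsOfHodgeType A.dim A.X (2 * 1) 1 1 b ∧ w' = cupProduct (two_mul_add_two_mul 2 1) a b} ⊔
        Submodule.span ℂ {w' : complexBetti A.X (2 * 3) |
          ∃ (C : AbelianVariety ℂ) (g : A.X ⟶ C.X) (w : complexBetti C.X (2 * 3)), C.dim < A.dim ∧
            IsRationalClass w ∧ IsOfHodgeType C.dim C.X (2 * 3) 3 3 w ∧ w' = complexBetti.map g (2 * 3) w} ⊔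
        Submodule.span ℂ {w' : complexBetti A.X (2 * 3) |
          ∃ (B' : AbelianVariety ℂ) (g : A.X ⟶ B'.X) (d : ℕ) (ψ : B' ⟶ B') (w : complexBetti B'.X (2 * 3)),
            B'.dim = 6 ∧ 0 < d ∧ ψ ≫ ψ = -(d • 𝟙 B') ∧ IsRationalClass w ∧
            IsOfHodgeType B'.dim B'.X (2 * 3) 3 3 w ∧ w ∈ weilClassesOf B' ψ 3 d ∧
            w' = complexBetti.map g (2 * 3) w}) := by
  haveI : HodgeTensorFacts.{0, 0} := hodgeTensorFacts_holds
  exact census_row9_ksymm_ofLie A φ d e a hW hE2 (fun ψ ↦ hW.mem_hodgeLieC_of_commute_of_skew_of_trace hE2 ψ) ha ha0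

/-- **Row 9 with `h_K`, every member, on the whole ISOGENY CLASS — no Lie ∕ Hodge-group hypothesis.**
[cite: vanGeemen1994HodgeAV, Thm. 6.12 and Lemma 3.7] [cite: MoonenZarhin1999LowDim, §5 (5.1)] -/
theorem census_row9_ksymm_of_isIsogenous {A' : AbelianVariety ℂ} (hW : IsWeilType A φ 3 d)
    (hE2 : Module.finrank ℚ A.endAlgebra = 2)
    (ha : IsRationalClass a) (ha0 : a ≠ 0) (hA'A : IsIsogenous A' A) :
    (A'.dim = 6 ∧ ¬ (IsOfCMType A' ∨ ProdCMCell IsQuarticFieldTypeIVFourfold (fun Z ↦ Z.dim = 2) A')) ∧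
    (∀ c : complexBetti A'.X (2 * 2), IsRationalClass c → IsOfHodgeType A'.dim A'.X (2 * 2) 2 2 c →
      c ∈ divisorClassesSpan A'.X A'.dim 2 ⊔ Submodule.span ℂ {w' : complexBetti A'.X (2 * 2) |
        ∃ (C : AbelianVariety ℂ) (g : A'.X ⟶ C.X) (w : complexBetti C.X (2 * 2)), C.dim < A'.dim ∧
          IsRationalClass w ∧ IsOfHodgeType C.dim C.X (2 * 2) 2 2 w ∧ w' = complexBetti.map g (2 * 2) w}) ∧
    (∀ c : complexBetti A'.X (2 * 3), IsRationalClass c → IsOfHodgeType A'.dim A'.X (2 * 3) 3 3 c →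
      c ∈ divisorClassesSpan A'.X A'.dim 3 ⊔ Submodule.span ℂ {w' : complexBetti A'.X (2 * 3) |
          ∃ (a : complexBetti A'.X (2 * 2)) (b : complexBetti A'.X (2 * 1)),
            IsRationalClass a ∧ IsOfHodgeType A'.dim A'.X (2 * 2) 2 2 a ∧ IsRationalClass b ∧
            IsOfHodgeType A'.dim A'.X (2 * 1) 1 1 b ∧ w' = cupProduct (two_mul_add_two_mul 2 1) a b} ⊔
        Submodule.span ℂ {w' : complexBetti A'.X (2 * 3) |
          ∃ (C : AbelianVariety ℂ) (g : A'.X ⟶ C.X) (w : complexBetti C.X (2 * 3)), C.dim < A'.dim ∧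
            IsRationalClass w ∧ IsOfHodgeType C.dim C.X (2 * 3) 3 3 w ∧ w' = complexBetti.map g (2 * 3) w} ⊔
        Submodule.span ℂ {w' : complexBetti A'.X (2 * 3) |
          ∃ (B' : AbelianVariety ℂ) (g : A'.X ⟶ B'.X) (d : ℕ) (ψ : B' ⟶ B') (w : complexBetti B'.X (2 * 3)),
            B'.dim = 6 ∧ 0 < d ∧ ψ ≫ ψ = -(d • 𝟙 B') ∧ IsRationalClass w ∧
            IsOfHodgeType B'.dim B'.X (2 * 3) 3 3 w ∧ w ∈ weilClassesOf B' ψ 3 d ∧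
            w' = complexBetti.map g (2 * 3) w}) := by
  haveI : HodgeTensorFacts.{0, 0} := hodgeTensorFacts_holds
  exact census_row9_ksymm_ofLie_of_isIsogenous A φ d e a hW hE2
    (fun ψ ↦ hW.mem_hodgeLieC_of_commute_of_skew_of_trace hE2 ψ) ha ha0 hA'A

/-- **HC for every row-9 member with `End⁰ = K` ⟸ the ladder item `WeilSixfolds` (DISPLAYED, not asserted)** — the `_ofLie`
version with `hSU` discharged by B4′. HC NOT proved unconditionally. [cite: vanGeemen1994HodgeAV, 2.4 and Thm. 6.12]
[cite: MoonenZarhin1999LowDim, Thm. 0.2] -/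
theorem hodgeConjectureFor_row9_ksymm_of_weilSixfolds (hW₆ : Theses.SevenfoldWeilCensus.WeilSixfolds)
    (hW : IsWeilType A φ 3 d) (hE2 : Module.finrank ℚ A.endAlgebra = 2)
    (ha : IsRationalClass a) (ha0 : a ≠ 0) : HodgeConjectureFor A.dim A.X := by
  haveI : HodgeTensorFacts.{0, 0} := hodgeTensorFacts_holds
  exact hodgeConjectureFor_row9_ksymm_ofLie_of_weilSixfolds A φ d e a hW₆ hW hE2
    (fun ψ ↦ hW.mem_hodgeLieC_of_commute_of_skew_of_trace hE2 ψ) ha ha0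

/-- **HC for every row-9 member with `End⁰ = K` ⟸ {Markman₆, R-W6} (both DISPLAYED: preprint ∕ open)** — the `_ofLie` version
with `hSU` discharged by B4′. HC NOT proved unconditionally. [cite: Markman2025SecantWeil, Thm. 1.5.1 (preprint, unrefereed)]
[claim: Markman2025SurveySecant, status: under-review] [cite: vanGeemen1994HodgeAV, Thm. 6.12] -/
theorem hodgeConjectureFor_row9_ksymm_of_markman₆_nonsplit
    (hMark₆ : Markman2025_weilClasses_algebraic_hyperbolicSixfold) (hRW6 : WeilTypeLadder.NonsplitSixfolds)
    (hW : IsWeilType A φ 3 d) (hE2 : Module.finrank ℚ A.endAlgebra = 2)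
    (ha : IsRationalClass a) (ha0 : a ≠ 0) : HodgeConjectureFor A.dim A.X := by
  haveI : HodgeTensorFacts.{0, 0} := hodgeTensorFacts_holds
  exact hodgeConjectureFor_row9_ksymm_ofLie_of_markman₆_nonsplit A φ d e a hMark₆ hRW6 hW hE2
    (fun ψ ↦ hW.mem_hodgeLieC_of_commute_of_skew_of_trace hE2 ψ) ha ha0

/-- **… and on the whole isogeny class.** Markman₆ ∕ R-W6 displayed; HC NOT proved unconditionally.
[cite: vanGeemen1994HodgeAV, Lemma 3.7 and Thm. 6.12] [cite: Markman2025SecantWeil, Thm. 1.5.1 (preprint, unrefereed)] -/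
theorem hodgeConjectureFor_of_isIsogenous_row9_ksymm_of_markman₆_nonsplit {A' : AbelianVariety ℂ}
    (hMark₆ : Markman2025_weilClasses_algebraic_hyperbolicSixfold) (hRW6 : WeilTypeLadder.NonsplitSixfolds)
    (hW : IsWeilType A φ 3 d) (hE2 : Module.finrank ℚ A.endAlgebra = 2)
    (ha : IsRationalClass a) (ha0 : a ≠ 0) (hA'A : IsIsogenous A' A) : HodgeConjectureFor A'.dim A'.X := by
  haveI : HodgeTensorFacts.{0, 0} := hodgeTensorFacts_holds
  exact hodgeConjectureFor_of_isIsogenous_row9_ksymm_ofLie_of_markman₆_nonsplit A φ d e a hMark₆ hRW6 hW hE2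
    (fun ψ ↦ hW.mem_hodgeLieC_of_commute_of_skew_of_trace hE2 ψ) ha ha0 hA'A

end KSymm

end Summit.HodgeConjecture.HodgeConjecture.TableX.WeilLieRows
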